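import Summits.ABC.IUTFork.Cor312StatementBridge
import HarnessLib

/-!
# D-0123(C) IUT REPAIR-CATALOGUE (rung LADDER-ABC:A2), row RC-667 (rcat-lit-5 L5-22 / LANA §9.3 (9-1)): the ORDER
# variant of LANA's MAIN GOAL — «SOME possible image of the Θ-pilot object has log-volume ≥ −|log(q)|» — placed in
# the readings lattice of the fork skeleton and carried to the verbatim statement of [IUTchIII] Cor. 3.12

Record file (D-0012) of the abc-iut cell, seat abc-iut-rcat-tst-2 (tester, KERNEL-CLOSE column); PROOF-ONLY (no new
definition, no hypothesis-as-definition, no instance, no notation). TAKES NO SIDE on [IUTchIII] Cor. 3.12 /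
[IUTchIV] Thm. 1.10, on any reading, or on any author (D-0045); nothing here asserts abc proved or refuted. The
reading is a claim-tagged HYPOTHESIS shape, never a Literature fact. typed ≠ proved; located ≠ adjudicated.

THE SHAPE. Over a skeleton `Cor312Setting C` (abc-iut XVII `ForkRegions`: one volume container, possible images
`U_λ`, their holomorphic hull `U^{hol}`, the `q`-pilot image `Q`; `Cor312 := ln ν̄(Q) ≤ ln ν̄(U^{hol})`), LANA's (9-1)
«the set of procession-normalized log-volumes of the admissible output regions contains the `q`-pilot log-volume
as one of its possible values» is READING 1, `RepresentedVol := ∃ λ, ln ν̄(U_λ) = ln ν̄(Q)` ([cite: LANA2026Report,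
§8.3 p. 43; §9.2 (9-1) p. 46]). Row RC-667's kernel-close word left ONE clause «UNTESTED(needs typing)»: the ORDER
variant `∃ λ, ln ν̄(Q) ≤ ln ν̄(U_λ)` («dominated»; written below with the existential spelled out, no new `def`).
THIS FILE types it and decides its position:

* §1 `cor312_of_dominated` — dominated ⟹ `Cor312` (through `logvol_U_le_negLogTheta`: every image lies in the hull);
  `dominated_of_representedVol` — Reading 1 ⟹ dominated.
* §2 three separating containers (finite carriers `ℕ`, indicator volumes, hull = identity, all regions admissible):
  `dominated_not_imp_readings` — dominated ∧ ¬Reading 1 ∧ ¬Reading 2 (XVII's own `witnessSetting`: image `{0,1}` of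
  volume `2`, `Q = {0,5}` of volume `1`); `cor312_and_readings24_not_imp_dominated` — `Cor312` ∧ Reading 2
  (`QSubHull`) ∧ Reading 4 (`QIsoInHull`) ∧ ¬dominated (two images `{0}`, `{1}` of volume `1` each, `Q = {0,1}` of
  volume `2` = the volume of the hull `{0,1}`: the inequality holds by UNION/HULL INFLATION only);
  `dominated_not_imp_qIsoInHull` — dominated ∧ ¬Reading 4 (one image `{0}` carrying an atom of weight `2`, `Q = {1}`
  of volume `1`: no region inside the hull `{0}` has volume exactly `1`). HENCE: Reading 1 ⟹ dominated ⟹ `Cor312`,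
  both strict; dominated is INCOMPARABLE with Reading 2 and with Reading 4. In particular the order variant is
  STRICTLY STRONGER than the typed inequality at the skeleton level — the row's open clause is DECIDED there.
* §3 at abc-iut-c312-7's VERBATIM `Cor312.Setting` (under abc-iut-c312-6's `BridgeHyps`): `statement_of_dominated` —
  a GLOBAL possible image `U` (`Cor312Vol.ImageChoice`) with assembled log-volume `≥ −|log(q)|` gives the printed
  `Statement`; `assemble_logvol_imageChoice_eq_processionNormalized` — that assembled log-volume IS the
  procession-normalised sum `PN_j Σ_{v_ℚ} ln μ^log(U_{j,v_ℚ})` of the packet log-volumes (the form in which the row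
  was worded, and the form of the tree's per-image numbers, e.g. abc-iut-s2-p9
  `processionNormalized_imageChoice_settingPrVolSharp`); `statement_of_dominated_perPacket` — the same edge in that
  form. No verbatim-level separating instance is constructed here (the separations of §2 are skeleton containers,
  exactly as XVII's `readings_differ`).

Sources: LANA §8.3 p. 43, §9.2–9.3 pp. 46–47 [cite: LANA2026Report, §9.2 (9-1) p. 46]; [IUTchIII] Cor. 3.12
pp. 173–174 [claim: Mochizuki2012, status: disputed]. Classical axioms only.
-/

noncomputable section

open Set

namespace Summit.ABC

namespace IUTFork

namespace Repair.RcatLana91Order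

/-! ## §1. The order variant implies the inequality; Reading 1 implies the order variant -/

/-- **dominated ⟹ Cor. 3.12 (skeleton)**: if some possible image `U_λ` has `ln ν̄(Q) ≤ ln ν̄(U_λ)`, then
`ln ν̄(Q) ≤ ln ν̄(U^{hol})`, since every image lies in the hull of the union (`logvol_U_le_negLogTheta`).
Hypothesis shape, not asserted. [cite: LANA2026Report, §9.2 (9-1) p. 46] -/
theorem cor312_of_dominated (C : Cor312Setting) (h : ∃ i, C.negAbsLogq ≤ C.logvol (C.U i)) : C.Cor312 := by
  obtain ⟨i, hi⟩ := h
  exact hi.trans (C.logvol_U_le_negLogTheta i)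

/-- **Reading 1 ⟹ dominated**: an image of log-volume exactly `ln ν̄(Q)` is in particular one of log-volume
`≥ ln ν̄(Q)`. [folklore] -/
theorem dominated_of_representedVol (C : Cor312Setting) (h : C.RepresentedVol) :
    ∃ i, C.negAbsLogq ≤ C.logvol (C.U i) := by
  obtain ⟨i, hi⟩ := h
  exact ⟨i, hi.ge⟩

/-! ## §2. Three separating containers -/

/-- **dominated ∧ ¬Reading 1 ∧ ¬Reading 2** — XVII's witness setting (one possible image `{0,1}` of log-volume `2`,
`Q = {0,5}` of log-volume `1`, hull = identity): `1 ≤ 2`, `2 ≠ 1`, `5 ∉ {0,1}`. So dominated is STRICTLY weaker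
than Reading 1 and does not give Reading 2. [folklore] -/
theorem dominated_not_imp_readings :
    ∃ C : Cor312Setting, (∃ i, C.negAbsLogq ≤ C.logvol (C.U i)) ∧ ¬ C.RepresentedVol ∧ ¬ C.QSubHull := by
  have h01 : witnessContainer.logvol ({0, 1} : Set ℕ) = 2 := by
    simp only [witnessContainer, Set.indicator_apply, Set.mem_insert_iff, Set.mem_singleton_iff]
    norm_num
  have h05 : witnessContainer.logvol ({0, 5} : Set ℕ) = 1 := by
    simp only [witnessContainer, Set.indicator_apply, Set.mem_insert_iff, Set.mem_singleton_iff]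
    norm_num
  have hU : (⋃ _ : Unit, ({0, 1} : Set ℕ)) = {0, 1} := Set.iUnion_const _
  have hhol : witnessSetting.Uhol = ({0, 1} : Set ℕ) := by
    show ClosureOperator.id (Set ℕ) (⋃ _ : Unit, ({0, 1} : Set ℕ)) = {0, 1}
    rw [hU]
    rfl
  refine ⟨witnessSetting, ⟨(), ?_⟩, ?_, ?_⟩
  · show witnessContainer.logvol ({0, 5} : Set ℕ) ≤ witnessContainer.logvol ({0, 1} : Set ℕ)
    rw [h01, h05]
    norm_num
  · rintro ⟨_, h⟩
    change witnessContainer.logvol ({0, 1} : Set ℕ) = witnessContainer.logvol ({0, 5} : Set ℕ) at h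
    rw [h01, h05] at h
    norm_num at h
  · intro h
    have h5' : (5 : ℕ) ∈ witnessSetting.Uhol := h (show (5 : ℕ) ∈ ({0, 5} : Set ℕ) by simp)
    rw [hhol] at h5'
    have h5 : (5 : ℕ) ∈ ({0, 1} : Set ℕ) := h5'
    simp at h5

/-- **Cor. 3.12 ∧ Reading 2 ∧ Reading 4 ∧ ¬dominated** — over XVII's witness container (`ln ν̄(A) = 𝟙_A(0) + 𝟙_A(1)`,
hull = identity) take TWO possible images `U_b = {b.toNat}` (`b : Bool`; log-volume `1` each) and `Q = {0,1}`
(log-volume `2`). The hull of the union is `{0,1}` (log-volume `2`), so `Cor312` (`2 ≤ 2`), `QSubHull` (`Q ⊆ {0,1}`)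
and `QIsoInHull` hold, while NO single image dominates `Q` (`¬ 2 ≤ 1`): the inequality holds by union/hull inflation
alone. So dominated is STRICTLY stronger than `Cor312` and is not given by Readings 2 or 4. [folklore] -/
theorem cor312_and_readings24_not_imp_dominated :
    ∃ C : Cor312Setting, C.Cor312 ∧ C.QSubHull ∧ C.QIsoInHull ∧ ¬ ∃ i, C.negAbsLogq ≤ C.logvol (C.U i) := by
  have h01 : witnessContainer.logvol ({0, 1} : Set ℕ) = 2 := by
    simp only [witnessContainer, Set.indicator_apply, Set.mem_insert_iff, Set.mem_singleton_iff]
    norm_num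
  have hb : ∀ b : Bool, witnessContainer.logvol ({b.toNat} : Set ℕ) = 1 := by
    intro b
    cases b <;>
      · simp only [witnessContainer, Set.indicator_apply, Set.mem_singleton_iff, Bool.toNat_true,
          Bool.toNat_false]
        norm_num
  have hU : (⋃ b : Bool, ({b.toNat} : Set ℕ)) = {0, 1} := by
    ext x
    simp only [Set.mem_iUnion, Set.mem_singleton_iff, Set.mem_insert_iff, Bool.exists_bool, Bool.toNat_false,
      Bool.toNat_true]
  let C : Cor312Setting :=
    { toVolumeContainer := witnessContainer
      Idx := Bool
      U := fun b => ({b.toNat} : Set ℕ)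
      U_adm := fun _ => trivial
      Uhol_adm := trivial
      Q := ({0, 1} : Set ℕ)
      Q_adm := trivial }
  have hhol : C.Uhol = ({0, 1} : Set ℕ) := by
    show ClosureOperator.id (Set ℕ) (⋃ b : Bool, ({b.toNat} : Set ℕ)) = {0, 1}
    rw [hU]
    rfl
  have hsub : C.QSubHull := by
    show ({0, 1} : Set ℕ) ⊆ C.Uhol
    rw [hhol]
  refine ⟨C, ?_, hsub, C.qIsoInHull_of_qSubHull hsub, ?_⟩
  · show witnessContainer.logvol ({0, 1} : Set ℕ) ≤ witnessContainer.logvol C.Uhol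
    rw [hhol]
  · rintro ⟨b, h⟩
    change witnessContainer.logvol ({0, 1} : Set ℕ) ≤ witnessContainer.logvol ({b.toNat} : Set ℕ) at h
    rw [h01, hb] at h
    norm_num at h

/-- **dominated ∧ ¬Reading 4 (∧ ¬Reading 1 ∧ ¬Reading 2)** — a container on `ℕ` whose point `0` is an atom of
weight `2` (`ln ν̄(A) = 2·𝟙_A(0) + 𝟙_A(1)`, monotone; hull = identity; all regions admissible), one possible image
`{0}` (log-volume `2`) and `Q = {1}` (log-volume `1`): dominated (`1 ≤ 2`), but the regions inside the hull `{0}` are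
`∅` and `{0}`, of log-volumes `0` and `2`, so NO region in the hull has log-volume `ln ν̄(Q) = 1` — Yamashita's
Reading 4 fails (as do Readings 1, 2). So dominated does not give Reading 4 either: the two are incomparable
(`cor312_and_readings24_not_imp_dominated`). [folklore] -/
theorem dominated_not_imp_qIsoInHull :
    ∃ C : Cor312Setting, (∃ i, C.negAbsLogq ≤ C.logvol (C.U i)) ∧ ¬ C.QIsoInHull ∧ ¬ C.RepresentedVol ∧
      ¬ C.QSubHull := by
  let V : VolumeContainer :=
    { L := ℕ
      Adm := fun _ => True
      logvol := fun A => A.indicator (fun _ => (2 : ℝ)) 0 + A.indicator (fun _ => (1 : ℝ)) 1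
      logvol_mono := fun _ _ _ _ hAB =>
        add_le_add (Set.indicator_le_indicator_of_subset hAB (fun _ => zero_le_two) 0)
          (Set.indicator_le_indicator_of_subset hAB (fun _ => zero_le_one) 1)
      hull := ClosureOperator.id (Set ℕ) }
  let C : Cor312Setting :=
    { toVolumeContainer := V
      Idx := Unit
      U := fun _ => ({0} : Set ℕ)
      U_adm := fun _ => trivial
      Uhol_adm := trivial
      Q := ({1} : Set ℕ)
      Q_adm := trivial }
  have h0 : V.logvol ({0} : Set ℕ) = 2 := by
    simp only [V, Set.indicator_apply, Set.mem_singleton_iff]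
    norm_num
  have h1 : V.logvol ({1} : Set ℕ) = 1 := by
    simp only [V, Set.indicator_apply, Set.mem_singleton_iff]
    norm_num
  have he : V.logvol (∅ : Set ℕ) = 0 := by
    simp only [V, Set.indicator_empty, add_zero]
  have hU : (⋃ _ : Unit, ({0} : Set ℕ)) = {0} := Set.iUnion_const _
  have hhol : C.Uhol = ({0} : Set ℕ) := by
    show ClosureOperator.id (Set ℕ) (⋃ _ : Unit, ({0} : Set ℕ)) = {0}
    rw [hU]
    rfl
  refine ⟨C, ⟨(), ?_⟩, ?_, ?_, ?_⟩
  · show V.logvol ({1} : Set ℕ) ≤ V.logvol ({0} : Set ℕ)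
    rw [h0, h1]
    norm_num
  · rintro ⟨R, -, hR, hvol⟩
    change V.logvol R = V.logvol ({1} : Set ℕ) at hvol
    rw [hhol] at hR
    rcases Set.subset_singleton_iff_eq.mp hR with rfl | rfl
    · rw [he, h1] at hvol
      norm_num at hvol
    · rw [h0, h1] at hvol
      norm_num at hvol
  · rintro ⟨_, h⟩
    change V.logvol ({0} : Set ℕ) = V.logvol ({1} : Set ℕ) at h
    rw [h0, h1] at h
    norm_num at h
  · intro h
    have h1' : (1 : ℕ) ∈ C.Uhol := h (show (1 : ℕ) ∈ ({1} : Set ℕ) by simp)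
    rw [hhol] at h1'
    have h10 : (1 : ℕ) ∈ ({0} : Set ℕ) := h1'
    simp at h10

/-! ## §3. At the verbatim statement of [IUTchIII] Cor. 3.12 (abc-iut-c312-7), under abc-iut-c312-6's bridge hypotheses -/

namespace Verbatim

open Cor312Vol

variable {T : Thm311.ThetaIndex} {S : Thm311.Situation T} {P : Cor312.Setting S}

/-- **The order variant of (9-1) ⟹ the printed statement**: under `BridgeHyps`, if SOME global possible image `U`
of the Θ-pilot object (a possible image in every packet `(j, v_ℚ)`, `j ∈ 𝔽_l^⋇`) has assembled log-volume
`≥ −|log(q)|`, then `−|log(Θ)| ∈ ℝ` and `−|log(Θ)| ≥ −|log(q)|` (c312-7's `Statement`): the image's volume is at most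
`−|log(Θ)|` (`logvol_imageChoice_le_negLogTheta`). Hypothesis shape; the hypothesis is NOT asserted.
[cite: LANA2026Report, §9.2 (9-1) p. 46] [claim: Mochizuki2012, status: disputed] -/
theorem statement_of_dominated (H : BridgeHyps P)
    (h : ∃ U : ImageChoice P, P.negLogQ ≤ (toLocalFamily P H.mono).assemble.logvol (Set.univ.pi U.1)) :
    P.Statement := by
  obtain ⟨U, hU⟩ := h
  refine ⟨?_, (WithTop.coe_le_coe.mpr hU).trans (logvol_imageChoice_le_negLogTheta H U)⟩
  rw [← toCor312Setting_negLogTheta H]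
  exact WithTop.coe_ne_top

/-- Reading 1's hypothesis (abc-iut-c312-6 `statement_of_represented`: an image of assembled log-volume EXACTLY
`−|log(q)|`) is a special case of the order variant's. [folklore] -/
theorem dominated_of_represented (H : BridgeHyps P)
    (h : ∃ U : ImageChoice P, (toLocalFamily P H.mono).assemble.logvol (Set.univ.pi U.1) = P.negLogQ) :
    ∃ U : ImageChoice P, P.negLogQ ≤ (toLocalFamily P H.mono).assemble.logvol (Set.univ.pi U.1) := by
  obtain ⟨U, hU⟩ := h
  exact ⟨U, hU.ge⟩

/-- **The assembled log-volume of a global possible image IS the procession-normalised sum of its packet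
log-volumes**, `PN_j Σ_{v_ℚ} ln μ^log_{j,v_ℚ}(U_{j,v_ℚ})` ([IUTchIII] Prop. 3.9 (i) «average over `j ∈ 𝔽_l^⋇`», (iii)
«sum over `v_ℚ`»): the box formula `assemble_logvol_pi` (images are nonempty, `possibleImages_nonempty`) and the
bookkeeping `finsum_eq_processionNormalized` (finite support per label, from `BridgeHyps.image_fin`).
[claim: Mochizuki2012, status: disputed] -/
theorem assemble_logvol_imageChoice_eq_processionNormalized (H : BridgeHyps P) (U : ImageChoice P) :
    (toLocalFamily P H.mono).assemble.logvol (Set.univ.pi U.1) =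
      Literature.IUT.LogThetaLattice.processionNormalized fun i : Fin T.lstar =>
        ∑ᶠ vQ : T.VQ, (S.D P.n).logvol (Cor312.Setting.labelSucc i) vQ (U.1 (i, vQ)) := by
  rw [LocalFamily.assemble_logvol_pi _ _ fun t => possibleImages_nonempty H _ _ (U.2 t)]
  refine finsum_eq_processionNormalized
    (fun t : Fin T.lstar × T.VQ => (S.D P.n).logvol (Cor312.Setting.labelSucc t.1) t.2 (U.1 t)) fun i => ?_
  have hl : (1 / (T.lstar : ℝ)) ≠ 0 :=
    one_div_ne_zero (Nat.cast_ne_zero.mpr (Nat.pos_iff_ne_zero.mp (Fin.pos i)))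
  have hfin : (Function.support fun t : Fin T.lstar × T.VQ =>
      (S.D P.n).logvol (Cor312.Setting.labelSucc t.1) t.2 (U.1 t)).Finite :=
    (H.image_fin U).subset fun t ht => mul_ne_zero hl ht
  exact (hfin.image Prod.snd).subset fun vQ hv => ⟨(i, vQ), hv, rfl⟩

/-- **The order variant in the per-packet form** (the wording of row RC-667: `∃ U, −|log(q)| ≤ PN_j Σ_{v_ℚ}
ln μ^log(U_{j,v_ℚ})`) ⟹ the printed statement. Hypothesis shape, not asserted.
[cite: LANA2026Report, §9.2 (9-1) p. 46] [claim: Mochizuki2012, status: disputed] -/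
theorem statement_of_dominated_perPacket (H : BridgeHyps P)
    (h : ∃ U : ImageChoice P, P.negLogQ ≤
      Literature.IUT.LogThetaLattice.processionNormalized fun i : Fin T.lstar =>
        ∑ᶠ vQ : T.VQ, (S.D P.n).logvol (Cor312.Setting.labelSucc i) vQ (U.1 (i, vQ))) :
    P.Statement := by
  obtain ⟨U, hU⟩ := h
  exact statement_of_dominated H ⟨U, by rwa [assemble_logvol_imageChoice_eq_processionNormalized H U]⟩

end Verbatim

end Repair.RcatLana91Order

end IUTFork

end Summit.ABC

end
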